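import Literature.AlgebraicGeometry.Resolution.TameDescentLemmas
import Literature.AlgebraicGeometry.Resolution.RelAlgClosedRootLayers
import Literature.AlgebraicGeometry.Resolution.TameValuationIndependence
import Literature.AlgebraicGeometry.Resolution.ApproximationDegreeGenerators
import Literature.AlgebraicGeometry.Resolution.RelAlgClosedImmediate
import Literature.AlgebraicGeometry.Resolution.SplitApproximationType
import Literature.AlgebraicGeometry.Resolution.KnafKuhlmann2009Thm11
import Mathlib.RingTheory.Trace.Basic
import HarnessLib

/-!
# The trace of a henselian generator through a tame root layer (Kuhlmann–Vlahu 2014, Lemma 14.4)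

Topic: `Literature/AlgebraicGeometry/Resolution` (valued function fields). F.-V. Kuhlmann,
I. Vlahu, *The relative approximation degree in valued function fields*, Math. Z. 276 (2014) =
arXiv:1304.0200, §14 — the pull-down of henselian rationality through a tame Galois extension,
which is the algebraic counterpart of the descent step (through `L^{mr}`, by [Duc]) in
M. Temkin, *Inseparable local uniformization*, J. Algebra 373 (2013), Thm. 3.2.3, Step 1, on the
way to Thm. 3.3.1 = the named fact `Temkin2013RelativeCurveSmoothFibre`:

> **Lemma 14.4.** There is an element `d ∈ L` such that `𝐡_K(x : Tr_{F^h.L|F^h}(d·x)) = 1`.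
> *Proof.* … every `ρᵢ(x)` is transcendental … we can choose approximation coefficients `dᵢ`
> of `ρᵢ(x)` in `x` … `Gal(L|K)` is valuation independent. This means we can choose an element
> `d ∈ L` such that (13.1) holds with `σᵢ = ρᵢ|_L`. Then for `kᵢ := σᵢ(d) = ρᵢ(d)`, the
> hypothesis (12.4) of Lemma 12.3 holds. In view of the previous lemma and Corollary 10.8 we
> have that `𝐡(x:ρᵢ(x)) = 1`. From Lemma 12.3 we can now infer that
> `𝐡(x : Tr(d·x)) = 𝐡(x : ∑ᵢ ρᵢ(d)·ρᵢ(x)) = 1`.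

## Setting (this file and `TameDescent.lean`)

Inside an algebraically closed valued field `(Ω, V)` of characteristic `p` (residue
characteristic `p`): subfields `C ≤ E` with `C` PERFECT, henselian, of rank one, every element
of `E` algebraic over `C` lying in `C`, `E` henselian and `(E|C, V)` immediate (in the
application `E = F^h` for a function field `F` and `C` the relative algebraic closure of the
perfect hull of the ground field); a ROOT LAYER `L = C(roots of P)`, `P ∈ C[X]`
(`RelAlgClosedRootLayers.lean`), finite Galois over `C`, which is TAME in the sense that its
ramification group is trivial (`ramificationGroupIn V L = ⊥`, `KrullRamificationGroups.lean`;
Kuhlmann–Vlahu Thm. 13.2), and the compositum `M = E(roots of P) = E·L`, finite Galois over `E`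
with `Gal(M|E) ↪ Gal(L|C)` by restriction; an element `x ∈ M`, transcendental, not a limit of
elements of `L`, with `M ⊆ L(x)^h` — i.e. `(E·L | L)` is henselian rational with generator `x`.
The roles of the printed `K ⊆ L`, `F^h`, `F^h.L = L(x)^h` are played by `C ⊆ L`, `E`, `M`.

## Content (PROVED; no definitions, no named facts)

* bookkeeping for the layer: `L ≤ M` as subfields, `L` perfect and henselian, `M` henselian,
  `M ∩ C̃ = L`, `(M|L)` immediate (`isImmediateOver_rootLayer`, through
  `RelAlgClosedImmediate.lean` — no defect theory), rank one, and the hypotheses (10.1) of the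
  relative approximation degree over `L` for transcendental elements of `M`
  (`kaplansky_rootLayer`: transcendental approximation type from `L`-splitness of `M`,
  Temkin 2013 Cor. 3.1.10).
* `exists_good_trace` — **Lemma 14.4 in concrete degree-one form**: there is `y ∈ E` (the trace
  `∑_σ σ(d)σ(x)` for a suitable `d ∈ L`), transcendental over `L`, with a good approximant
  `g(x)`, `g` over `L`, of relative approximation degree `1` at `x`
  [cite: KuhlmannVlahu2014, Lemma 14.4].

## Sources

* F.-V. Kuhlmann, I. Vlahu, Math. Z. 276 (2014) = arXiv:1304.0200, §12 (Lemmas 12.2–12.3),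
  §13 (Thm. 13.2), §14 (Lemmas 14.1–14.4), pp. 22–26. [KuhlmannVlahu2014]
* M. Temkin, J. Algebra 373 (2013) = arXiv:0804.1554, Cor. 3.1.10, Thm. 3.2.3 (Step 1).
  [Temkin2013]
-/

noncomputable section

open Polynomial Finset IsLocalRing IntermediateField Module

namespace Literature.AlgebraicGeometry.Resolution

universe u

variable {Ω : Type u} [Field Ω] [IsAlgClosed Ω] (V : ValuationSubring Ω)

/-! ### Bookkeeping for the root layer `L = C(roots P) ⊆ M = E(roots P)` -/

section Layer

variable {C E : Subfield Ω} (hCE : C ≤ E) (P : Polynomial C)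

omit [IsAlgClosed Ω] in
/-- `C ≤ L`. [folklore] -/
theorem le_toSubfield_adjoin_rootSet :
    C ≤ (IntermediateField.adjoin C (P.rootSet Ω)).toSubfield := fun c hc =>
  (IntermediateField.adjoin C (P.rootSet Ω)).algebraMap_mem ⟨c, hc⟩

omit [IsAlgClosed Ω] in
/-- `E ≤ M`. [folklore] -/
theorem le_toSubfield_adjoin_rootSet_top :
    E ≤ (IntermediateField.adjoin E (P.rootSet Ω)).toSubfield := fun c hc =>
  (IntermediateField.adjoin E (P.rootSet Ω)).algebraMap_mem ⟨c, hc⟩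

omit [IsAlgClosed Ω] in
include hCE in
/-- `L ≤ M` as subfields of `Ω`. [folklore] -/
theorem toSubfield_adjoin_rootSet_le :
    (IntermediateField.adjoin C (P.rootSet Ω)).toSubfield ≤
      (IntermediateField.adjoin E (P.rootSet Ω)).toSubfield := fun _ hw =>
  coe_adjoin_rootSet_subset hCE P hw

omit [IsAlgClosed Ω] in
/-- Elements of `L` are algebraic over `C`. [folklore] -/
theorem isAlgebraic_of_mem_toSubfield_adjoin_rootSet {a : Ω}
    (ha : a ∈ (IntermediateField.adjoin C (P.rootSet Ω)).toSubfield) : IsAlgebraic C a := by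
  haveI : FiniteDimensional C (IntermediateField.adjoin C (P.rootSet Ω)) :=
    finiteDimensional_adjoin_rootSet_subfield P
  exact IntermediateField.isAlgebraic_iff.mp
    (Algebra.IsAlgebraic.isAlgebraic (⟨a, ha⟩ : IntermediateField.adjoin C (P.rootSet Ω)))

omit [IsAlgClosed Ω] in
include hCE in
/-- Elements of `M` are algebraic over `E`. [folklore] -/
theorem isAlgebraic_of_mem_toSubfield_adjoin_rootSet_top {a : Ω}
    (ha : a ∈ (IntermediateField.adjoin E (P.rootSet Ω)).toSubfield) : IsAlgebraic E a := by
  haveI : FiniteDimensional E (IntermediateField.adjoin E (P.rootSet Ω)) :=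
    finiteDimensional_adjoin_rootSet_top_subfield hCE P
  exact IntermediateField.isAlgebraic_iff.mp
    (Algebra.IsAlgebraic.isAlgebraic (⟨a, ha⟩ : IntermediateField.adjoin E (P.rootSet Ω)))

omit [IsAlgClosed Ω] in
/-- `PerfectField C` from `p`-th roots in `C`. [folklore] -/
theorem perfectField_of_forall_exists_pow_eq (p : ℕ) [hp : Fact p.Prime] [CharP Ω p]
    (hperf : ∀ y ∈ C, ∃ b ∈ C, b ^ p = y) : PerfectField C := by
  haveI : ExpChar C p := ExpChar.prime hp.out
  haveI : PerfectRing C p := PerfectRing.ofSurjective C p fun y => by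
    obtain ⟨b, hb, h⟩ := hperf y y.2
    exact ⟨⟨b, hb⟩, Subtype.ext (by simpa [frobenius] using h)⟩
  exact PerfectRing.toPerfectField C p

omit [IsAlgClosed Ω] in
/-- **`L` is perfect**: `p`-th roots in the finite separable extension `L` of the perfect `C`.
[folklore] -/
theorem exists_pow_eq_of_mem_toSubfield_adjoin_rootSet (p : ℕ) [hp : Fact p.Prime] [CharP Ω p]
    (hperf : ∀ y ∈ C, ∃ b ∈ C, b ^ p = y) {y : Ω}
    (hy : y ∈ (IntermediateField.adjoin C (P.rootSet Ω)).toSubfield) :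
    ∃ b ∈ (IntermediateField.adjoin C (P.rootSet Ω)).toSubfield, b ^ p = y := by
  haveI : PerfectField C := perfectField_of_forall_exists_pow_eq p hperf
  haveI : FiniteDimensional C (IntermediateField.adjoin C (P.rootSet Ω)) :=
    finiteDimensional_adjoin_rootSet_subfield P
  haveI : Algebra.IsAlgebraic C (IntermediateField.adjoin C (P.rootSet Ω)) :=
    Algebra.IsAlgebraic.of_finite C _
  haveI : PerfectField (IntermediateField.adjoin C (P.rootSet Ω)) :=
    Algebra.IsAlgebraic.perfectField (K := C)
  haveI : ExpChar (IntermediateField.adjoin C (P.rootSet Ω)) p := ExpChar.prime hp.out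
  haveI : PerfectRing (IntermediateField.adjoin C (P.rootSet Ω)) p := PerfectField.toPerfectRing p
  obtain ⟨b, hb⟩ := surjective_frobenius (IntermediateField.adjoin C (P.rootSet Ω)) p ⟨y, hy⟩
  refine ⟨b, b.2, ?_⟩
  have := congrArg (fun z : IntermediateField.adjoin C (P.rootSet Ω) => (z : Ω)) hb
  simpa [frobenius] using this

omit [IsAlgClosed Ω] in
/-- **`L` is henselian** (finite over the henselian `C`). [cite: Kuhlmann2010, Lemma 2.3] -/
theorem isHenselianField_toSubfield_adjoin_rootSet
    (hC : IsHenselianField C (V.comap (algebraMap C Ω))) :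
    IsHenselianField (IntermediateField.adjoin C (P.rootSet Ω)).toSubfield
      (V.comap (algebraMap (IntermediateField.adjoin C (P.rootSet Ω)).toSubfield Ω)) :=
  IsHenselianField.of_subfield_algebraic V (le_toSubfield_adjoin_rootSet P)
    (fun _ ha => isAlgebraic_of_mem_toSubfield_adjoin_rootSet P ha) hC

omit [IsAlgClosed Ω] in
include hCE in
/-- **`M` is henselian** (finite over the henselian `E`). [cite: Kuhlmann2010, Lemma 2.3] -/
theorem isHenselianField_toSubfield_adjoin_rootSet_top
    (hE : IsHenselianField E (V.comap (algebraMap E Ω))) :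
    IsHenselianField (IntermediateField.adjoin E (P.rootSet Ω)).toSubfield
      (V.comap (algebraMap (IntermediateField.adjoin E (P.rootSet Ω)).toSubfield Ω)) :=
  IsHenselianField.of_subfield_algebraic V (le_toSubfield_adjoin_rootSet_top P)
    (fun _ ha => isAlgebraic_of_mem_toSubfield_adjoin_rootSet_top hCE P ha) hE

include hCE in
/-- **`M ∩ C̃ = L`, subfield form**: an element of `M` algebraic over `L` lies in `L` (for `C`
perfect and algebraically closed in `E`). [folklore] -/
theorem mem_toSubfield_adjoin_rootSet_of_isAlgebraic (p : ℕ) [hp : Fact p.Prime] [CharP Ω p]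
    (hperf : ∀ y ∈ C, ∃ b ∈ C, b ^ p = y) (hrel : ∀ a ∈ E, IsAlgebraic C a → a ∈ C) {a : Ω}
    (haM : a ∈ (IntermediateField.adjoin E (P.rootSet Ω)).toSubfield)
    (ha : IsAlgebraic (IntermediateField.adjoin C (P.rootSet Ω)).toSubfield a) :
    a ∈ (IntermediateField.adjoin C (P.rootSet Ω)).toSubfield := by
  haveI : PerfectField C := perfectField_of_forall_exists_pow_eq p hperf
  have haC : IsAlgebraic C a :=
    isAlgebraic_trans_subfield (le_toSubfield_adjoin_rootSet P)
      (fun _ hw => isAlgebraic_of_mem_toSubfield_adjoin_rootSet P hw) ha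
  exact mem_adjoin_rootSet_of_isAlgebraic hCE P hrel haM haC

include hCE in
/-- **`(M|L)` is immediate** when `(E|C)` is: `M` is henselian, `L` is perfect and
algebraically closed in `M`, `vM/vL` is torsion (`M|E` algebraic, `vE = vC ⊆ vL`) and `Mv|Lv` is
algebraic — so `RelAlgClosedImmediate.lean` applies; no defect theory is needed.
[cite: KuhlmannVlahu2014, Section 14 (Lemma 14.2, "(F^h.L|L,v) is again immediate")] -/
theorem isImmediateOver_rootLayer (p : ℕ) [hp : Fact p.Prime] [CharP Ω p]
    [CharP (ResidueField V) p]
    (hperf : ∀ y ∈ C, ∃ b ∈ C, b ^ p = y) (hrel : ∀ a ∈ E, IsAlgebraic C a → a ∈ C)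
    (hE : IsHenselianField E (V.comap (algebraMap E Ω))) (himm : IsImmediateOver V C E) :
    IsImmediateOver V (IntermediateField.adjoin C (P.rootSet Ω)).toSubfield
      (IntermediateField.adjoin E (P.rootSet Ω)).toSubfield := by
  set Lf := (IntermediateField.adjoin C (P.rootSet Ω)).toSubfield with hLf
  set Mf := (IntermediateField.adjoin E (P.rootSet Ω)).toSubfield with hMf
  have hLM : Lf ≤ Mf := toSubfield_adjoin_rootSet_le hCE P
  have hCL : C ≤ Lf := le_toSubfield_adjoin_rootSet P
  have hEM : E ≤ Mf := le_toSubfield_adjoin_rootSet_top P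
  refine isImmediateOver_of_forall_isAlgebraic_mem V p hLM
    (fun y hy => exists_pow_eq_of_mem_toSubfield_adjoin_rootSet P p hperf hy)
    (isHenselianField_toSubfield_adjoin_rootSet_top V hCE P hE)
    (fun a haM ha => mem_toSubfield_adjoin_rootSet_of_isAlgebraic hCE P p hperf hrel haM ha)
    (fun a haM ha0 => ?_) (fun r hrM hrV => ?_)
  · -- values: `v(a^n) = v(b)`, `b ∈ E`, and `v(b) = v(c)`, `c ∈ C ⊆ L`
    obtain ⟨n, hn, b, hbE, hb⟩ := exists_valuation_pow_eq_of_isAlgebraic V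
      (isAlgebraic_of_mem_toSubfield_adjoin_rootSet_top hCE P haM) ha0
    have hb0 : b ≠ 0 := by
      rintro rfl
      rw [map_zero, map_pow, pow_eq_zero_iff hn, map_eq_zero] at hb
      exact ha0 hb
    obtain ⟨c, hcC, hbc⟩ := himm.1 b hbE hb0
    exact ⟨n, hn, c, hCL hcC, hb.trans hbc⟩
  · -- residues: algebraic over `Ev = Cv ⊆ Lv`
    have h1 : IsAlgebraic (resField V E) (residue V ⟨r, hrV⟩) :=
      isAlgebraic_residue_of_isAlgebraic V hrV
        (isAlgebraic_of_mem_toSubfield_adjoin_rootSet_top hCE P hrM)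
    have h2 : IsAlgebraic (resField V C) (residue V ⟨r, hrV⟩) := by
      have hle : resField V E ≤ resField V C := himm.2
      have hge : resField V C ≤ resField V E := resField_mono V hCE
      have heq : resField V E = resField V C := le_antisymm hle hge
      rw [← heq]; exact h1
    exact isAlgebraic_of_subfield_le (resField_mono V hCL) h2

omit [IsAlgClosed Ω] in
include hCE in
/-- **Rank one** passes from `C` to `M`. [folklore] -/
theorem isRankOneValued_toSubfield_adjoin_rootSet_top (hr1 : IsRankOneValued V C)
    (himm : IsImmediateOver V C E) :
    IsRankOneValued V (IntermediateField.adjoin E (P.rootSet Ω)).toSubfield :=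
  IsRankOneValued.of_algebraic V (le_toSubfield_adjoin_rootSet_top P) (hr1.of_isImmediateOver hCE himm)
    fun _ ha => isAlgebraic_of_mem_toSubfield_adjoin_rootSet_top hCE P ha

omit [IsAlgClosed Ω] in
/-- Transcendence in polynomial form. [folklore] -/
theorem forall_eval_eq_zero_imp_of_transcendental {K : Subfield Ω} {x : Ω} (hxt : Transcendental K x) :
    ∀ Q : Polynomial Ω, (∀ k, Q.coeff k ∈ K) → Q.eval x = 0 → Q = 0 := by
  intro Q hQ hQx
  obtain ⟨Q', hQ'⟩ : ∃ Q' : Polynomial K, Q'.map (algebraMap K Ω) = Q :=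
    (Polynomial.mem_lifts Q).mp ((Polynomial.lifts_iff_coeff_lifts Q).mpr
      fun k => ⟨⟨Q.coeff k, hQ k⟩, rfl⟩)
  by_contra hQ0
  refine hxt ⟨Q', fun h => hQ0 ?_, ?_⟩
  · rw [← hQ', h, Polynomial.map_zero]
  · rw [Polynomial.aeval_def, ← Polynomial.eval_map, hQ', hQx]

omit [IsAlgClosed Ω] in
/-- Immediateness data in the `hval`/`hres` form of the relative approximation degree files.
[folklore] -/
theorem hres_of_isImmediateOver {K F : Subfield Ω} (himm : IsImmediateOver V K F) :
    ∀ w ∈ F, w ∈ V → ∃ c ∈ K, V.valuation (w - c) < 1 := by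
  intro w hw hwV
  have hrw : residue V ⟨w, hwV⟩ ∈ resField V K := himm.2 (residue_mem_resField V ⟨w, hwV⟩ hw)
  obtain ⟨c, hcK, hcw⟩ := (mem_resField_iff V K _).mp hrw
  refine ⟨c, hcK, ?_⟩
  have h0 : residue V (⟨w, hwV⟩ - c) = 0 := by rw [map_sub, hcw, sub_self]
  exact (ValuationSubring.valuation_lt_one_iff V (⟨w, hwV⟩ - c)).mp ((residue_eq_zero_iff _).mp h0)

include hCE in
/-- **The hypotheses (10.1) over `L` for a transcendental element of `M`.** For `z ∈ M`
transcendental over `C`: `z` is transcendental over `L` (polynomial form), `(L(z)|L, V)` is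
immediate and of rank one, and `z` has transcendental approximation type over `L` (Kaplansky's
condition `h3`) — the latter because `M` is `L`-split (Temkin 2013, Cor. 3.1.10,
`DeeplyRamifiedSplit.lean`, `SplitApproximationType.lean`). [folklore] -/
theorem kaplansky_rootLayer (p : ℕ) [hp : Fact p.Prime] [CharP Ω p] [CharP (ResidueField V) p]
    (hperf : ∀ y ∈ C, ∃ b ∈ C, b ^ p = y) (hrel : ∀ a ∈ E, IsAlgebraic C a → a ∈ C)
    (hC : IsHenselianField C (V.comap (algebraMap C Ω)))
    (hE : IsHenselianField E (V.comap (algebraMap E Ω))) (hr1 : IsRankOneValued V C)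
    (himm : IsImmediateOver V C E) {z : Ω}
    (hzM : z ∈ (IntermediateField.adjoin E (P.rootSet Ω)).toSubfield) (hzt : Transcendental C z) :
    (∀ Q : Polynomial Ω, (∀ k, Q.coeff k ∈ (IntermediateField.adjoin C (P.rootSet Ω)).toSubfield) →
        Q.eval z = 0 → Q = 0) ∧
    IsImmediateOver V (IntermediateField.adjoin C (P.rootSet Ω)).toSubfield
      (Subfield.closure (((IntermediateField.adjoin C (P.rootSet Ω)).toSubfield : Set Ω) ∪ {z})) ∧
    IsRankOneValued V
      (Subfield.closure (((IntermediateField.adjoin C (P.rootSet Ω)).toSubfield : Set Ω) ∪ {z})) ∧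
    (∀ g : Polynomial Ω, (∀ k, g.coeff k ∈ (IntermediateField.adjoin C (P.rootSet Ω)).toSubfield) →
      ∃ a₀ ∈ (IntermediateField.adjoin C (P.rootSet Ω)).toSubfield, ∃ α : V.ValueGroup,
        ∀ a ∈ (IntermediateField.adjoin C (P.rootSet Ω)).toSubfield,
          V.valuation (z - a) ≤ V.valuation (z - a₀) → V.valuation (g.eval a) = α) := by
  set Lf := (IntermediateField.adjoin C (P.rootSet Ω)).toSubfield with hLf
  set Mf := (IntermediateField.adjoin E (P.rootSet Ω)).toSubfield with hMf
  have hLM : Lf ≤ Mf := toSubfield_adjoin_rootSet_le hCE P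
  have hCL : C ≤ Lf := le_toSubfield_adjoin_rootSet P
  -- transcendence over `L`
  have hztL : Transcendental Lf z := fun hza =>
    hzt (isAlgebraic_trans_subfield hCL (fun _ hw => isAlgebraic_of_mem_toSubfield_adjoin_rootSet P hw) hza)
  have htrans := forall_eval_eq_zero_imp_of_transcendental hztL
  -- immediateness and rank one
  set Lz : Subfield Ω := Subfield.closure ((Lf : Set Ω) ∪ {z}) with hLz
  have hLzM : Lz ≤ Mf := Subfield.closure_le.mpr (Set.union_subset hLM (Set.singleton_subset_iff.mpr hzM))
  have himmM : IsImmediateOver V Lf Mf := isImmediateOver_rootLayer V hCE P p hperf hrel hE himm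
  have himmz : IsImmediateOver V Lf Lz := himmM.mono_right hLzM
  have hr1L : IsRankOneValued V Lf :=
    IsRankOneValued.of_algebraic V hCL hr1 fun _ hw => isAlgebraic_of_mem_toSubfield_adjoin_rootSet P hw
  have hr1z : IsRankOneValued V Lz := hr1L.of_isImmediateOver
    (fun c hc => Subfield.subset_closure (Or.inl hc)) himmz
  -- splitness of `M` over `L` (Cor. 3.1.10) and Kaplansky's condition
  have hL : IsHenselianField Lf (V.comap (algebraMap Lf Ω)) := isHenselianField_toSubfield_adjoin_rootSet V P hC
  have hM : IsHenselianField Mf (V.comap (algebraMap Mf Ω)) := isHenselianField_toSubfield_adjoin_rootSet_top V hCE P hE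
  have hperfL : ∀ y ∈ Lf, ∃ b ∈ Lf, b ^ p = y := fun y hy =>
    exists_pow_eq_of_mem_toSubfield_adjoin_rootSet P p hperf hy
  have hrelM : ∀ a ∈ Mf, IsAlgebraic Lf a → a ∈ Lf := fun a haM ha =>
    mem_toSubfield_adjoin_rootSet_of_isAlgebraic hCE P p hperf hrel haM ha
  have hsplit : ∀ θ g : Ω, IsAlgebraic Lf θ → IsAlgebraic Lf g →
      (∀ c ∈ Lf, V.valuation g ≤ V.valuation (z - c)) → V.valuation g ≤ V.valuation (z - θ) :=
    fun θ g hθ hg hfar =>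
      valuation_le_sub_of_forall_isAlgebraic_mem_of_perfect V p hLM hL hperfL hr1L hM hrelM hzM hθ hg hfar
  have h3 := kaplansky_condition_of_split V Lf htrans himmz hsplit
  exact ⟨htrans, himmz, hr1z, h3⟩


/-! ### Kuhlmann–Vlahu 2014, Lemma 14.4 (with `𝐡 = 1`, concrete form) -/

include hCE in
/-- **Kuhlmann–Vlahu 2014, Lemma 14.4 — the trace of the generator has relative approximation
degree `1`.** In the setting of the module docstring (`C ≤ E` with `C` perfect, henselian, of
rank one and algebraically closed in the henselian `E`, `(E|C)` immediate; the tame root layer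
`L = C(roots P)` with trivial ramification group; `M = E(roots P)`; `x ∈ M` transcendental, not a
limit of elements of `L`, with `M ⊆ L(x)^h`), there are `y ∈ E` and a polynomial `g` over `L`
such that `y` is transcendental over `L`, `g(x)` is a GOOD approximant of `y` (`|y − g(x)| < |y − b|`
for all `b ∈ L`) and `|g(x) − g(c)| = β |x − c|` for `c ∈ L` close to `x` (`β ≠ 0`): in the
printed language, `𝐡_L(x : y) = 1`. PROVED as printed: `y = ∑_σ σ(d) σ(x) = Tr_{M|E}(d x)` where,
for each `σ ∈ Gal(M|E)`, `L(σ x)^h = L(x)^h` (Lemma 14.3), so `σ(x)` has a good approximant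
`f^{[σ]}(x)` of relative approximation degree `1` (Cor. 10.8, `exists_good_approximant_of_degree_one`)
with approximation coefficient `d_σ ∈ L` (Lemma 12.2), and `d ∈ L` is chosen by the valuation
independence of `Gal(L|C) ↩ Gal(M|E)` (Thm. 13.2, `exists_valuation_mul_apply_le_sum`) so that
the `σ(d) d_σ` do not cancel; then Lemma 12.3 (`good_approximant_sum`).
[cite: KuhlmannVlahu2014, Lemma 14.4] -/
theorem exists_good_trace (p : ℕ) [hp : Fact p.Prime] [CharP Ω p] [CharP (ResidueField V) p]
    (hperf : ∀ y ∈ C, ∃ b ∈ C, b ^ p = y) (hrel : ∀ a ∈ E, IsAlgebraic C a → a ∈ C)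
    (hC : IsHenselianField C (V.comap (algebraMap C Ω)))
    (hE : IsHenselianField E (V.comap (algebraMap E Ω))) (hr1 : IsRankOneValued V C)
    (himm : IsImmediateOver V C E)
    (hram : ramificationGroupIn V (IntermediateField.adjoin C (P.rootSet Ω)) = ⊥)
    {x : Ω} (hxM : x ∈ (IntermediateField.adjoin E (P.rootSet Ω)).toSubfield)
    (hxt : Transcendental C x)
    (hex : ∃ e ∈ (IntermediateField.adjoin C (P.rootSet Ω)).toSubfield, e ≠ 0 ∧
      ∀ b ∈ (IntermediateField.adjoin C (P.rootSet Ω)).toSubfield,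
        V.valuation e ≤ V.valuation (x - b))
    (hMx : ((IntermediateField.adjoin E (P.rootSet Ω) : IntermediateField E Ω) : Set Ω) ⊆
      henselization V (Subfield.closure
        (((IntermediateField.adjoin C (P.rootSet Ω)).toSubfield : Set Ω) ∪ {x}))) :
    ∃ y ∈ E,
      (∀ Q : Polynomial Ω,
        (∀ k, Q.coeff k ∈ (IntermediateField.adjoin C (P.rootSet Ω)).toSubfield) →
          Q.eval y = 0 → Q = 0) ∧
      ∃ g : Polynomial Ω,
        (∀ k, g.coeff k ∈ (IntermediateField.adjoin C (P.rootSet Ω)).toSubfield) ∧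
        (∀ b ∈ (IntermediateField.adjoin C (P.rootSet Ω)).toSubfield,
          V.valuation (y - g.eval x) < V.valuation (y - b)) ∧
        ∃ β : V.ValueGroup, β ≠ 0 ∧
          ∃ a₀ ∈ (IntermediateField.adjoin C (P.rootSet Ω)).toSubfield,
            ∀ c ∈ (IntermediateField.adjoin C (P.rootSet Ω)).toSubfield,
              V.valuation (x - c) ≤ V.valuation (x - a₀) →
                V.valuation (g.eval x - g.eval c) = β * V.valuation (x - c) ^ 1 := by
  classical
  haveI : PerfectField C := perfectField_of_forall_exists_pow_eq p hperf
  haveI : FiniteDimensional E (IntermediateField.adjoin E (P.rootSet Ω)) :=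
    finiteDimensional_adjoin_rootSet_top_subfield hCE P
  haveI : IsGalois E (IntermediateField.adjoin E (P.rootSet Ω)) := isGalois_adjoin_rootSet_top hCE P
  haveI : FiniteDimensional C (IntermediateField.adjoin C (P.rootSet Ω)) :=
    finiteDimensional_adjoin_rootSet_subfield P
  haveI : Algebra.IsAlgebraic E (IntermediateField.adjoin E (P.rootSet Ω)) :=
    Algebra.IsAlgebraic.of_finite E _
  haveI : Algebra.IsAlgebraic C (IntermediateField.adjoin C (P.rootSet Ω)) :=
    Algebra.IsAlgebraic.of_finite C _
  have hLM : (IntermediateField.adjoin C (P.rootSet Ω)).toSubfield ≤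
      (IntermediateField.adjoin E (P.rootSet Ω)).toSubfield := toSubfield_adjoin_rootSet_le hCE P
  have hEM : E ≤ (IntermediateField.adjoin E (P.rootSet Ω)).toSubfield :=
    le_toSubfield_adjoin_rootSet_top P
  have hrelM : ∀ a ∈ (IntermediateField.adjoin E (P.rootSet Ω)).toSubfield,
      IsAlgebraic (IntermediateField.adjoin C (P.rootSet Ω)).toSubfield a →
        a ∈ (IntermediateField.adjoin C (P.rootSet Ω)).toSubfield := fun a haM ha =>
    mem_toSubfield_adjoin_rootSet_of_isAlgebraic hCE P p hperf hrel haM ha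
  -- (10.1) for `x` over `L`
  obtain ⟨htransx, himmx, hr1x, h3x⟩ := kaplansky_rootLayer V hCE P p hperf hrel hC hE hr1 himm hxM hxt
  have hxL : x ∉ (IntermediateField.adjoin C (P.rootSet Ω)).toSubfield :=
    not_mem_of_forall_eval_eq_zero _ htransx
  have hvalx := himmx.1
  have hresx := hres_of_isImmediateOver V himmx
  obtain ⟨e, heL, he0, hefar⟩ := hex
  -- the Galois group of `M|E`: values preserved, `L` stabilized
  have hvalσ : ∀ (σ : (IntermediateField.adjoin E (P.rootSet Ω)) ≃ₐ[E]
      (IntermediateField.adjoin E (P.rootSet Ω))) (z : IntermediateField.adjoin E (P.rootSet Ω)),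
      V.valuation ((σ z : IntermediateField.adjoin E (P.rootSet Ω)) : Ω) = V.valuation (z : Ω) :=
    fun σ z => hE.valuation_algHom_apply V
      ((IsScalarTower.toAlgHom E (IntermediateField.adjoin E (P.rootSet Ω)) Ω).comp σ.toAlgHom) z
  have hstab : ∀ (σ : (IntermediateField.adjoin E (P.rootSet Ω)) ≃ₐ[E]
      (IntermediateField.adjoin E (P.rootSet Ω))) (z : IntermediateField.adjoin E (P.rootSet Ω)),
      (z : Ω) ∈ (IntermediateField.adjoin C (P.rootSet Ω)).toSubfield →
        ((σ z : IntermediateField.adjoin E (P.rootSet Ω)) : Ω) ∈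
          (IntermediateField.adjoin C (P.rootSet Ω)).toSubfield :=
    fun σ z hz => coe_algEquiv_apply_mem_adjoin_rootSet hCE P σ hz
  set xM : IntermediateField.adjoin E (P.rootSet Ω) := ⟨x, hxM⟩ with hxMdef
  have hxMcoe : (xM : Ω) = x := rfl
  -- the conjugates `σ x` are transcendental over `C`
  have hyt : ∀ σ : (IntermediateField.adjoin E (P.rootSet Ω)) ≃ₐ[E]
      (IntermediateField.adjoin E (P.rootSet Ω)),
      Transcendental C ((σ xM : IntermediateField.adjoin E (P.rootSet Ω)) : Ω) := by
    intro σ halg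
    have h1 : ((σ xM : IntermediateField.adjoin E (P.rootSet Ω)) : Ω) ∈
        (IntermediateField.adjoin C (P.rootSet Ω)).toSubfield :=
      mem_adjoin_rootSet_of_isAlgebraic hCE P hrel (σ xM).2 halg
    have h2 := hstab σ.symm _ h1
    rw [AlgEquiv.symm_apply_apply] at h2
    exact hxL h2
  have hdat := fun σ : (IntermediateField.adjoin E (P.rootSet Ω)) ≃ₐ[E]
      (IntermediateField.adjoin E (P.rootSet Ω)) =>
    kaplansky_rootLayer V hCE P p hperf hrel hC hE hr1 himm (σ xM).2 (hyt σ)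
  -- Lemma 14.3: `x ∈ L(σ x)^h`; and `σ x ∈ L(x)^h`
  have hxy : ∀ σ : (IntermediateField.adjoin E (P.rootSet Ω)) ≃ₐ[E]
      (IntermediateField.adjoin E (P.rootSet Ω)),
      x ∈ henselization V (Subfield.closure
        (((IntermediateField.adjoin C (P.rootSet Ω)).toSubfield : Set Ω) ∪
          {((σ xM : IntermediateField.adjoin E (P.rootSet Ω)) : Ω)})) := fun σ =>
    coe_subset_henselization_closure_of_algEquiv V (IntermediateField.adjoin E (P.rootSet Ω)) hE σ
      (B := ((IntermediateField.adjoin C (P.rootSet Ω)).toSubfield : Set Ω))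
      (fun w hw => hLM hw) (fun z hz => hstab σ z hz) xM hMx hxM
  have hyx : ∀ σ : (IntermediateField.adjoin E (P.rootSet Ω)) ≃ₐ[E]
      (IntermediateField.adjoin E (P.rootSet Ω)),
      ((σ xM : IntermediateField.adjoin E (P.rootSet Ω)) : Ω) ∈ henselization V (Subfield.closure
        (((IntermediateField.adjoin C (P.rootSet Ω)).toSubfield : Set Ω) ∪ {x})) :=
    fun σ => hMx (σ xM).2
  -- `σ x` is not a limit of elements of `L` either
  have heyfar : ∀ σ : (IntermediateField.adjoin E (P.rootSet Ω)) ≃ₐ[E]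
      (IntermediateField.adjoin E (P.rootSet Ω)),
      ∀ b ∈ (IntermediateField.adjoin C (P.rootSet Ω)).toSubfield,
        V.valuation e ≤ V.valuation (((σ xM : IntermediateField.adjoin E (P.rootSet Ω)) : Ω) - b) := by
    intro σ b hb
    set bM : IntermediateField.adjoin E (P.rootSet Ω) := ⟨b, hLM hb⟩ with hbM
    have hb' : ((σ.symm bM : IntermediateField.adjoin E (P.rootSet Ω)) : Ω) ∈
        (IntermediateField.adjoin C (P.rootSet Ω)).toSubfield := hstab σ.symm bM hb
    have h1 := hefar _ hb'
    have hid : ((σ xM : IntermediateField.adjoin E (P.rootSet Ω)) : Ω) - b =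
        ((σ (xM - σ.symm bM) : IntermediateField.adjoin E (P.rootSet Ω)) : Ω) := by
      rw [map_sub, AlgEquiv.apply_symm_apply]
      rfl
    rw [hid, hvalσ]
    exact h1
  -- Cor. 10.8: good approximants of degree one for the conjugates
  have hT5 : ∀ σ : (IntermediateField.adjoin E (P.rootSet Ω)) ≃ₐ[E]
      (IntermediateField.adjoin E (P.rootSet Ω)),
      ∃ f : Polynomial Ω, (∀ k, f.coeff k ∈ (IntermediateField.adjoin C (P.rootSet Ω)).toSubfield) ∧
        0 < f.natDegree ∧
        (∀ b ∈ (IntermediateField.adjoin C (P.rootSet Ω)).toSubfield,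
          V.valuation (((σ xM : IntermediateField.adjoin E (P.rootSet Ω)) : Ω) - f.eval x) <
            V.valuation (((σ xM : IntermediateField.adjoin E (P.rootSet Ω)) : Ω) - b)) ∧
        ∃ β : V.ValueGroup, β ≠ 0 ∧ ∃ a₀ ∈ (IntermediateField.adjoin C (P.rootSet Ω)).toSubfield,
          ∀ c ∈ (IntermediateField.adjoin C (P.rootSet Ω)).toSubfield,
            V.valuation (x - c) ≤ V.valuation (x - a₀) →
              V.valuation ((hasseDeriv 1 f).eval c) = β ∧
              (∀ i, 1 ≤ i → i ≠ 1 →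
                V.valuation ((hasseDeriv i f).eval c * (x - c) ^ i) < β * V.valuation (x - c) ^ 1) ∧
              V.valuation (f.eval x - f.eval c) = β * V.valuation (x - c) ^ 1 := fun σ =>
    exists_good_approximant_of_degree_one V _ htransx himmx h3x hr1x (hdat σ).1 (hdat σ).2.1
      (hdat σ).2.2.2 (hdat σ).2.2.1 heL he0 hefar heL he0 (heyfar σ) (hxy σ) (hyx σ)
  choose f hfL hfdeg hfgood β hβ a haL hfa using hT5
  -- Lemma 12.2: approximation coefficients
  have hT7 : ∀ σ : (IntermediateField.adjoin E (P.rootSet Ω)) ≃ₐ[E]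
      (IntermediateField.adjoin E (P.rootSet Ω)),
      ∃ d ∈ (IntermediateField.adjoin C (P.rootSet Ω)).toSubfield, V.valuation d = β σ ∧
        ∃ a₁ ∈ (IntermediateField.adjoin C (P.rootSet Ω)).toSubfield,
          ∀ c ∈ (IntermediateField.adjoin C (P.rootSet Ω)).toSubfield,
            V.valuation (x - c) ≤ V.valuation (x - a₁) →
              V.valuation ((hasseDeriv 1 (f σ)).eval c - d) < β σ := fun σ =>
    exists_approximationCoefficient V _ hxL hvalx hresx h3x (hfL σ) (hβ σ) (haL σ)
      (fun c hc hle => (hfa σ c hc hle).1)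
  choose d hdL hdβ a' ha'L hda' using hT7
  -- a common centre `a₀`
  set S : Finset Ω := (Finset.univ.image a) ∪ (Finset.univ.image a') with hSdef
  have hSne : S.Nonempty := ⟨a 1, Finset.mem_union_left _ (Finset.mem_image_of_mem a (Finset.mem_univ _))⟩
  obtain ⟨a₀, ha₀S, hmin⟩ := Finset.exists_min_image S (fun c => V.valuation (x - c)) hSne
  have ha₀L : a₀ ∈ (IntermediateField.adjoin C (P.rootSet Ω)).toSubfield := by
    rcases Finset.mem_union.mp ha₀S with h | h
    · obtain ⟨σ, -, rfl⟩ := Finset.mem_image.mp h; exact haL σ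
    · obtain ⟨σ, -, rfl⟩ := Finset.mem_image.mp h; exact ha'L σ
  have hca : ∀ σ, V.valuation (x - a₀) ≤ V.valuation (x - a σ) := fun σ =>
    hmin _ (Finset.mem_union_left _ (Finset.mem_image_of_mem a (Finset.mem_univ _)))
  have hca' : ∀ σ, V.valuation (x - a₀) ≤ V.valuation (x - a' σ) := fun σ =>
    hmin _ (Finset.mem_union_right _ (Finset.mem_image_of_mem a' (Finset.mem_univ _)))
  -- restriction to `L` and valuation independence of `Gal(L|C)`
  choose res hres using fun σ : (IntermediateField.adjoin E (P.rootSet Ω)) ≃ₐ[E]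
      (IntermediateField.adjoin E (P.rootSet Ω)) => exists_restrict_algEquiv hCE P σ
  have hinj : Function.Injective res := by
    intro σ σ' h
    refine algEquiv_eq_of_forall_coe_apply_eq P fun z hz => ?_
    apply Subtype.ext
    have h1 := hres σ ⟨z, hz⟩
    have h2 := hres σ' ⟨z, hz⟩
    rw [h] at h1
    have ez : (⟨((⟨(z : Ω), hz⟩ : IntermediateField.adjoin C (P.rootSet Ω)) : Ω),
        coe_adjoin_rootSet_subset hCE P hz⟩ : IntermediateField.adjoin E (P.rootSet Ω)) = z :=
      Subtype.ext rfl
    rw [ez] at h1 h2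
    exact h1.symm.trans h2
  have hVL : ∀ (τ : (IntermediateField.adjoin C (P.rootSet Ω)) ≃ₐ[C]
      (IntermediateField.adjoin C (P.rootSet Ω))) (z : IntermediateField.adjoin C (P.rootSet Ω)),
      V.valuation ((τ z : IntermediateField.adjoin C (P.rootSet Ω)) : Ω) = V.valuation (z : Ω) :=
    fun τ z => hC.valuation_algHom_apply V
      ((IsScalarTower.toAlgHom C (IntermediateField.adjoin C (P.rootSet Ω)) Ω).comp τ.toAlgHom) z
  set cc : ((IntermediateField.adjoin C (P.rootSet Ω)) ≃ₐ[C] (IntermediateField.adjoin C (P.rootSet Ω))) → Ω :=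
    Function.extend res d 0 with hccdef
  have hccres : ∀ σ, cc (res σ) = d σ := fun σ => hinj.extend_apply d 0 σ
  have hd0 : ∀ σ, d σ ≠ 0 := fun σ h0 => hβ σ (by rw [← hdβ σ, h0, map_zero])
  have hcc1 : ∃ τ, cc τ ≠ 0 := ⟨res 1, by rw [hccres]; exact hd0 1⟩
  obtain ⟨dd, hdd0, hSne0, hSmax⟩ :=
    exists_valuation_mul_apply_le_sum V (IntermediateField.adjoin C (P.rootSet Ω)) hVL hram cc hcc1
  -- the sum over `Gal(L|C)` is the sum over `Gal(M|E)`
  have hsum : ∑ τ, cc τ * ((τ dd : IntermediateField.adjoin C (P.rootSet Ω)) : Ω) =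
      ∑ σ, d σ * (((res σ) dd : IntermediateField.adjoin C (P.rootSet Ω)) : Ω) := by
    have h1 : ∑ τ ∈ Finset.univ.image res, cc τ * ((τ dd : IntermediateField.adjoin C (P.rootSet Ω)) : Ω) =
        ∑ τ, cc τ * ((τ dd : IntermediateField.adjoin C (P.rootSet Ω)) : Ω) := by
      apply Finset.sum_subset (Finset.subset_univ _)
      intro τ _ hτ
      have hne : ¬ ∃ σ, res σ = τ := fun ⟨σ, hσ⟩ =>
        hτ (Finset.mem_image.mpr ⟨σ, Finset.mem_univ _, hσ⟩)
      rw [hccdef, Function.extend_apply' _ _ _ hne, Pi.zero_apply, zero_mul]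
    rw [← h1, Finset.sum_image fun σ _ σ' _ h => hinj h]
    exact Finset.sum_congr rfl fun σ _ => by rw [hccres]
  -- the scalars `k_σ = σ(d)`
  set kk : ((IntermediateField.adjoin E (P.rootSet Ω)) ≃ₐ[E] (IntermediateField.adjoin E (P.rootSet Ω))) → Ω :=
    fun σ => (((res σ) dd : IntermediateField.adjoin C (P.rootSet Ω)) : Ω) with hkkdef
  have hkkL : ∀ σ, kk σ ∈ (IntermediateField.adjoin C (P.rootSet Ω)).toSubfield := fun σ => ((res σ) dd).2
  have hDS : ∑ σ, kk σ * d σ = ∑ τ, cc τ * ((τ dd : IntermediateField.adjoin C (P.rootSet Ω)) : Ω) := by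
    rw [hsum]
    exact Finset.sum_congr rfl fun σ _ => mul_comm _ _
  have hmax : ∀ σ ∈ (Finset.univ : Finset ((IntermediateField.adjoin E (P.rootSet Ω)) ≃ₐ[E]
      (IntermediateField.adjoin E (P.rootSet Ω)))),
      V.valuation (kk σ * d σ) ≤ V.valuation (∑ σ, kk σ * d σ) := by
    intro σ _
    have h1 := hSmax (res σ)
    rw [hccres] at h1
    rw [hDS, mul_comm]
    exact h1
  have hne : ∑ σ, kk σ * d σ ≠ 0 := by rw [hDS]; exact hSne0
  -- Lemma 12.3 in concrete form
  obtain ⟨hgK, hgoodY, hlinY⟩ := good_approximant_sum V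
    (IntermediateField.adjoin C (P.rootSet Ω)).toSubfield Finset.univ htransx hvalx hresx h3x
    f (fun σ _ => hfL σ) (fun σ => ((σ xM : IntermediateField.adjoin E (P.rootSet Ω)) : Ω)) β d kk
    (fun σ _ => hkkL σ) (fun σ _ => ⟨hdL σ, hdβ σ⟩) (fun σ _ => hfgood σ) ha₀L
    (fun σ _ c hc hle => by
      have h := (hfa σ c hc (hle.trans (hca σ))).2.2
      rwa [pow_one] at h)
    (fun σ _ c hc hle => ⟨hda' σ c hc (hle.trans (hca' σ)), fun j hj => by
      have h := (hfa σ c hc (hle.trans (hca σ))).2.1 j (by omega) (by omega)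
      rwa [pow_one] at h⟩)
    hmax hne
  -- the combination is a trace, hence lies in `E`
  set dM : IntermediateField.adjoin E (P.rootSet Ω) := ⟨(dd : Ω), hLM dd.2⟩ with hdMdef
  have hkkσ : ∀ σ, kk σ = ((σ dM : IntermediateField.adjoin E (P.rootSet Ω)) : Ω) := fun σ => hres σ dd
  have hYeq : ∑ σ, kk σ * ((σ xM : IntermediateField.adjoin E (P.rootSet Ω)) : Ω) =
      ((algebraMap E (IntermediateField.adjoin E (P.rootSet Ω))
        (Algebra.trace E (IntermediateField.adjoin E (P.rootSet Ω)) (dM * xM)) :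
          IntermediateField.adjoin E (P.rootSet Ω)) : Ω) := by
    rw [trace_eq_sum_automorphisms, AddSubmonoidClass.coe_finsetSum]
    refine Finset.sum_congr rfl fun σ _ => ?_
    rw [hkkσ, map_mul]
    rfl
  have hYE : (∑ σ, kk σ * ((σ xM : IntermediateField.adjoin E (P.rootSet Ω)) : Ω)) ∈ E := by
    rw [hYeq]
    exact (Algebra.trace E (IntermediateField.adjoin E (P.rootSet Ω)) (dM * xM)).2
  -- it is transcendental over `L`
  have hYL : (∑ σ, kk σ * ((σ xM : IntermediateField.adjoin E (P.rootSet Ω)) : Ω)) ∉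
      (IntermediateField.adjoin C (P.rootSet Ω)).toSubfield := fun hY => by
    have h := hgoodY _ hY
    rw [sub_self, map_zero] at h
    exact not_lt_zero h
  have hYt : Transcendental (IntermediateField.adjoin C (P.rootSet Ω)).toSubfield
      (∑ σ, kk σ * ((σ xM : IntermediateField.adjoin E (P.rootSet Ω)) : Ω)) := fun halg =>
    hYL (hrelM _ (hEM hYE) halg)
  refine ⟨_, hYE, forall_eval_eq_zero_imp_of_transcendental hYt, _, hgK, hgoodY,
    V.valuation (∑ σ, kk σ * d σ), (_root_.map_ne_zero _).mpr hne, a₀, ha₀L, hlinY⟩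

end Layer

end Literature.AlgebraicGeometry.Resolution

end
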